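import Summits.Schanuel.Schanuel.Theorems.RootDecomp1KHyper33

/-!
# RootDecomp1KHyper — lens 6, generation 15 ADDENDUM «EXP-LATTICE-ANCHORED CELL» (ExpAnchorT.lean v2 88910796…, 2341 l) — continuation (RootDecomp1KHyper34): §5c `evt` / `odt` / `yev` / `yod` / `yC`, `real_combo_eq_zero`, `yC_partial_approx`, `hyperLatApprox_yC`, `ternarySmallForms_yC`

(lens-6 g15-addendum `ExpAnchorT.lean` v2, sha256 88910796…cc8b, farm rc 0 · 0 sorry · axioms std; port by census-1 gen 14 in eight parts RootDecomp1KHyper28–35, cuts of CENSUS-REQUEST STATUS L1561 re-balanced for the 400-line cap,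
critic PORT GO L1568 (e) / ACK L1571; import `RootDecomp1KHyper26`, the source's verbatim g15 plane-lemma copy dropped (exported by Hyper26 in `…HyperCell`), sub-namespace `…HyperCell.LatCell` kept; statements and proofs verbatim
(55 docstrings added, seven generic one-liners privatised with per-part private copies); `hLW : LWMeasure` (tree-proved named fact) stays a binder; `--supports stmt-Schanuel-33363` (residual of record n = 3 := UnanchoredResidual₃′). Nothing here proves Schanuel; rung 0.)
-/

noncomputable section

open Complex IntermediateField Polynomial

namespace Summit.Schanuel.Schanuel.Theorems.RootDecomp1KHyper

namespace HyperCell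

namespace LatCell

variable {n : ℕ}
open Summit.Schanuel.Schanuel.Theorems.RootDecomp1KGeneric (HasHLPairInSpan Rank3SpanResidual
  mem_adjoin_of_mem_span cexp_mem_adjoin_of_mem_span)

/-- The integer form with coefficients `(−A, −B, E)` on `(w₁, w₂, y)` is `E·y − (A w₁ + B w₂)`. -/
private theorem latTriple_form (w₁ w₂ y : ℂ) (A B : ℤ) (E : ℕ) :
    ∑ i, ((![-A, -B, (E : ℤ)] : Fin 3 → ℤ) i : ℂ) * latTriple w₁ w₂ y i =
      (E : ℂ) * y - ((A : ℂ) * w₁ + (B : ℂ) * w₂) := by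
  rw [Fin.sum_univ_three]
  simp only [latTriple_zero, latTriple_one, latTriple_two, Matrix.cons_val_zero,
    Matrix.cons_val_one, Matrix.head_cons, Matrix.cons_val_two, Matrix.tail_cons]
  push_cast
  ring

/-- The height `Σ i, |h i|` of the coefficient vector `(−A, −B, E)` is `|A| + |B| + E`. -/
private theorem latTriple_hsum (A B : ℤ) (E : ℕ) :
    ∑ i, |(((![-A, -B, (E : ℤ)] : Fin 3 → ℤ) i : ℤ) : ℝ)| = |(A : ℝ)| + |(B : ℝ)| + E := by
  rw [Fin.sum_univ_three]
  simp only [Matrix.cons_val_zero, Matrix.cons_val_one, Matrix.head_cons, Matrix.cons_val_two,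
    Matrix.tail_cons, Int.cast_neg, abs_neg, Int.cast_natCast, Nat.abs_cast]

/-- `q · exp(−X^(m+1)) ≤ exp(−X^m)` for `0 < q ≤ X`, `1 ≤ X`. -/
private theorem mul_exp_neg_pow_succ_le {q X : ℝ} (hq : 0 < q) (hqX : q ≤ X) (hX : 1 ≤ X)
    (m : ℕ) : q * Real.exp (-(X ^ (m + 1))) ≤ Real.exp (-(X ^ m)) := by
  have hlog : Real.log q ≤ X ^ (m + 1) - X ^ m :=
    calc Real.log q ≤ q - 1 := Real.log_le_sub_one_of_pos hq
      _ ≤ X - 1 := by linarith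
      _ ≤ X ^ m * (X - 1) := le_mul_of_one_le_left (by linarith) (one_le_pow₀ hX)
      _ = X ^ (m + 1) - X ^ m := by ring
  rw [← Real.exp_log hq, ← Real.exp_add]
  exact Real.exp_le_exp.mpr (by linarith)

/-- `e ≤ 3`. -/
private theorem exp_one_le_three' : Real.exp 1 ≤ 3 := by
  have := Real.exp_one_lt_d9; norm_num at this; linarith

/-- `(1/3)^X ≤ exp(−X)`. -/
private theorem third_pow_le_exp_neg' (X : ℕ) : ((1 : ℝ) / 3) ^ X ≤ Real.exp (-(X : ℝ)) := by
  have h1 : (1 : ℝ) / 3 ≤ Real.exp (-1) := by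
    rw [Real.exp_neg, ← one_div]
    exact one_div_le_one_div_of_le (Real.exp_pos 1) exp_one_le_three'
  calc ((1 : ℝ) / 3) ^ X ≤ Real.exp (-1) ^ X := pow_le_pow_left₀ (by norm_num) h1 X
    _ = Real.exp (-(X : ℝ)) := by rw [← Real.exp_nat_mul]; ring_nf

/-- `3 · 16^{−X} < 3^{−X}` for `X ≥ 1`. -/
private theorem three_mul_sixteenth_pow_lt {X : ℕ} (hX : 1 ≤ X) :
    3 * ((1 : ℝ) / 16) ^ X < ((1 : ℝ) / 3) ^ X := by
  have e : ((1 : ℝ) / 3) ^ X = ((16 : ℝ) / 3) ^ X * ((1 : ℝ) / 16) ^ X := by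
    rw [← mul_pow]; norm_num
  rw [e]
  have h : (3 : ℝ) < ((16 : ℝ) / 3) ^ X :=
    calc (3 : ℝ) < 16 / 3 := by norm_num
      _ ≤ ((16 : ℝ) / 3) ^ X := le_self_pow₀ (by norm_num) (by omega)
  exact mul_lt_mul_of_pos_right h (by positivity)

/-! ## §5c  A member with a CERTIFIED empty hyper-Liouville-pair locus: `z_C = (1, e^{i√2}, y_C)`

Take the anchor exponent NON-REAL: `α_C = i√2 ∈ ℚ̄ ∖ ℚ`, `ξ_C = e^{i√2}` (`|ξ_C| = 1`,
`Im ξ_C = sin √2 ≠ 0`), and `y_C = y⁰ + ξ_C y¹` with the REAL lacunary series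
`y⁰ = Σ_{k even} 2^{−a_k}`, `y¹ = Σ_{k odd} 2^{−a_k}`.  Then `span_ℤ(z_C) = {(a + c y⁰) + (b + c y¹) ξ_C}`
and, `(1, ξ_C)` being an `ℝ`-basis of `ℂ`, a REAL ratio `ρ = v'/v` of two span elements forces the
`2 × 2` minors of their coefficient vectors to satisfy ONE integer linear relation in `(1, y⁰, y¹)` —
which is `ℤ`-free by the PLANE LEMMA (lacunarity of `a_k`).  Hence `ρ ∈ ℚ`: NO hyper-Liouville pair,
unconditionally (§5d). -/

/-- even part terms `[k even] 2^{−a_k}` -/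
def evt (k : ℕ) : ℝ := ytx 0 k
/-- odd part terms `[k odd] 2^{−a_k}` -/
def odt (k : ℕ) : ℝ := ytx 1 k - ytx 0 k

/-- The even-part terms are non-negative. -/
theorem evt_nonneg (k : ℕ) : 0 ≤ evt k := ytx_nonneg_of_le le_rfl k

/-- `ytx 1 k = 1 / 2^{a_k}`. -/
theorem ytx_one (k : ℕ) : ytx 1 k = 1 / (2 : ℝ) ^ hexp k := by simp [ytx]

/-- Even part plus odd part of the `k`-th term is `1 / 2^{a_k}`. -/
theorem evt_add_odt (k : ℕ) : evt k + odt k = 1 / (2 : ℝ) ^ hexp k := by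
  rw [evt, odt, ytx_one]; ring

/-- The odd-part terms are non-negative. -/
theorem odt_nonneg (k : ℕ) : 0 ≤ odt k := by
  unfold odt ytx pwx
  by_cases hk : Even k
  · simp [hk]
  · simp only [hk, if_false, zero_div, sub_zero]
    positivity

/-- The even-part series is summable. -/
theorem summable_evt : Summable evt := summable_ytx le_rfl (by norm_num)
/-- The odd-part series is summable. -/
theorem summable_odt : Summable odt :=
  (summable_ytx zero_le_one (by norm_num)).sub (summable_ytx le_rfl (by norm_num))

/-- `y⁰ = Σ_{k even} 2^{−a_k}`, `y¹ = Σ_{k odd} 2^{−a_k}`. -/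
def yev : ℝ := ∑' k, evt k
/-- `y¹ = Σ_{k odd} 2^{−a_k}`, the odd part. -/
def yod : ℝ := ∑' k, odt k

/-- Partial sums of the even part: `Σ_{k ≤ K} evt k = P_K / 2^{a_K}`. -/
theorem partialSum_evt (K : ℕ) : ∑ k ∈ Finset.range (K + 1), evt k = (pmP K : ℝ) / (2 : ℝ) ^ hexp K := by
  have h := partialSum_ytx 0 K
  simpa [evt] using h

/-- Partial sums of the odd part: `Σ_{k ≤ K} odt k = M_K / 2^{a_K}`. -/
theorem partialSum_odt (K : ℕ) : ∑ k ∈ Finset.range (K + 1), odt k = (pmM K : ℝ) / (2 : ℝ) ^ hexp K := by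
  simp only [odt]
  rw [Finset.sum_sub_distrib, partialSum_ytx, partialSum_ytx]
  ring

/-- Tails of the even-part series are summable. -/
theorem summable_evt_tail (K : ℕ) : Summable fun k => evt (k + K) :=
  (summable_nat_add_iff K).mpr summable_evt
/-- Tails of the odd-part series are summable. -/
theorem summable_odt_tail (K : ℕ) : Summable fun k => odt (k + K) :=
  (summable_nat_add_iff K).mpr summable_odt

/-- Tails of the even-part series are non-negative. -/
theorem evt_tail_nonneg (K : ℕ) : 0 ≤ ∑' k, evt (k + K) := tsum_nonneg fun _ => evt_nonneg _
/-- Tails of the odd-part series are non-negative. -/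
theorem odt_tail_nonneg (K : ℕ) : 0 ≤ ∑' k, odt (k + K) := tsum_nonneg fun _ => odt_nonneg _

/-- Even tail plus odd tail is the full tail `Σ_{k ≥ K} 2^{−a_k}`. -/
theorem evt_tail_add_odt_tail (K : ℕ) :
    ∑' k, evt (k + K) + ∑' k, odt (k + K) = ∑' k, 1 / (2 : ℝ) ^ hexp (k + K) := by
  rw [← (summable_evt_tail K).tsum_add (summable_odt_tail K)]
  exact tsum_congr fun k => evt_add_odt _

/-- `y⁰` is its `K`-th partial sum plus its tail. -/
theorem yev_eq_partialSum_add_tail (K : ℕ) :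
    yev = ∑ k ∈ Finset.range K, evt k + ∑' k, evt (k + K) :=
  (summable_evt.sum_add_tsum_nat_add K).symm
/-- `y¹` is its `K`-th partial sum plus its tail. -/
theorem yod_eq_partialSum_add_tail (K : ℕ) :
    yod = ∑ k ∈ Finset.range K, odt k + ∑' k, odt (k + K) :=
  (summable_odt.sum_add_tsum_nat_add K).symm

/-- `y_C(ξ) = y⁰ + ξ y¹`. -/
def yC (ξ : ℂ) : ℂ := (yev : ℂ) + ξ * (yod : ℂ)

/-- Real coefficients on the `ℝ`-basis `(1, ξ)`, `Im ξ ≠ 0`. -/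
private theorem real_combo_eq_zero {ξ : ℂ} (hξi : ξ.im ≠ 0) {p q : ℝ} (h : (p : ℂ) + ξ * (q : ℂ) = 0) :
    p = 0 ∧ q = 0 := by
  have him := congr_arg Complex.im h
  have hre := congr_arg Complex.re h
  simp only [Complex.add_im, Complex.ofReal_im, Complex.mul_im, Complex.ofReal_re, zero_add,
    mul_zero, Complex.zero_im] at him
  have hq : q = 0 := by
    rcases mul_eq_zero.mp him with h1 | h1
    · exact absurd h1 hξi
    · exact h1
  simp only [Complex.add_re, Complex.ofReal_re, Complex.mul_re, Complex.ofReal_im, mul_zero,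
    sub_zero, Complex.zero_re, hq, add_zero] at hre
  exact ⟨hre, hq⟩

/-- `‖p + ξ q‖ ≤ p + q` for `‖ξ‖ ≤ 1` and real `p, q ≥ 0`. -/
private theorem norm_real_combo_le {ξ : ℂ} (hξn : ‖ξ‖ ≤ 1) {p q : ℝ} (hp : 0 ≤ p) (hq : 0 ≤ q) :
    ‖(p : ℂ) + ξ * (q : ℂ)‖ ≤ p + q :=
  calc ‖(p : ℂ) + ξ * (q : ℂ)‖ ≤ ‖(p : ℂ)‖ + ‖ξ * (q : ℂ)‖ := norm_add_le _ _
    _ = p + ‖ξ‖ * q := by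
        rw [norm_mul, Complex.norm_real, Complex.norm_real, Real.norm_eq_abs, Real.norm_eq_abs,
          abs_of_nonneg hp, abs_of_nonneg hq]
    _ ≤ p + 1 * q := by gcongr
    _ = p + q := by ring

/-- **The certified approximation for `y_C`**: at `K = 3m + 3` the lattice point
`(P_K + M_K ξ)/2^{a_K}` of `(ℤ + ℤξ)/2^{a_K}` approximates `y_C(ξ)` within `exp(−X^m)` and is not equal
to it (`‖ξ‖ ≤ 1`, `Im ξ ≠ 0`). -/
theorem yC_partial_approx {ξ : ℂ} (hξn : ‖ξ‖ ≤ 1) (hξi : ξ.im ≠ 0) (m : ℕ) :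
    yC ξ ≠ ((((pmP (3 * m + 3) : ℤ) : ℂ)) * 1 + (((pmM (3 * m + 3) : ℤ) : ℂ)) * ξ) /
        (((2 ^ hexp (3 * m + 3) : ℕ) : ℂ)) ∧
      ‖yC ξ - ((((pmP (3 * m + 3) : ℤ) : ℂ)) * 1 + (((pmM (3 * m + 3) : ℤ) : ℂ)) * ξ) /
        (((2 ^ hexp (3 * m + 3) : ℕ) : ℂ))‖ <
        Real.exp (-((1 + ((2 ^ hexp (3 * m + 3) : ℕ) : ℝ) + |((pmP (3 * m + 3) : ℤ) : ℝ)| +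
          |((pmM (3 * m + 3) : ℤ) : ℝ)|) ^ m)) := by
  obtain ⟨K, hK⟩ : ∃ K : ℕ, K = 3 * m + 3 := ⟨_, rfl⟩
  rw [← hK]
  have hA1 : 1 ≤ hexp K := one_le_hexp K
  have h2 : (0 : ℝ) < 2 ^ hexp K := by positivity
  -- the tails
  set τ₀ : ℝ := ∑' k, evt (k + (K + 1)) with hτ₀
  set τ₁ : ℝ := ∑' k, odt (k + (K + 1)) with hτ₁
  have hτ₀0 : 0 ≤ τ₀ := evt_tail_nonneg _
  have hτ₁0 : 0 ≤ τ₁ := odt_tail_nonneg _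
  have hsum : τ₀ + τ₁ = ∑' k, 1 / (2 : ℝ) ^ hexp (k + (K + 1)) := evt_tail_add_odt_tail _
  have hpos : 0 < τ₀ + τ₁ := by rw [hsum]; exact lambdaH_tail_pos _
  have hev : yev - (pmP K : ℝ) / (2 : ℝ) ^ hexp K = τ₀ := by
    rw [yev_eq_partialSum_add_tail (K + 1), partialSum_evt]; ring
  have hod : yod - (pmM K : ℝ) / (2 : ℝ) ^ hexp K = τ₁ := by
    rw [yod_eq_partialSum_add_tail (K + 1), partialSum_odt]; ring
  have hC : yC ξ - ((((pmP K : ℤ) : ℂ)) * 1 + (((pmM K : ℤ) : ℂ)) * ξ) / (((2 ^ hexp K : ℕ) : ℂ)) =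
      (τ₀ : ℂ) + ξ * (τ₁ : ℂ) := by
    rw [← hev, ← hod, yC]
    push_cast
    field_simp
    ring
  refine ⟨?_, ?_⟩
  · intro h
    have h0 : (τ₀ : ℂ) + ξ * (τ₁ : ℂ) = 0 := by rw [← hC, h, sub_self]
    obtain ⟨h1, h2⟩ := real_combo_eq_zero hξi h0
    rw [h1, h2, add_zero] at hpos
    exact lt_irrefl _ hpos
  · rw [hC]
    set Y : ℕ := 2 ^ (m * (hexp K + 2)) with hY
    have hY1 : 1 ≤ Y := Nat.one_le_two_pow
    have hX : (1 + ((2 ^ hexp K : ℕ) : ℝ) + |((pmP K : ℤ) : ℝ)| + |((pmM K : ℤ) : ℝ)|) ^ m ≤ (Y : ℝ) := by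
      have hPM := pmP_add_pmM_le_pow K
      have h2A : (1 : ℝ) ≤ 2 ^ hexp K := one_le_pow₀ (by norm_num)
      have hle : 1 + ((2 ^ hexp K : ℕ) : ℝ) + |((pmP K : ℤ) : ℝ)| + |((pmM K : ℤ) : ℝ)| ≤
          (2 : ℝ) ^ (hexp K + 2) := by
        push_cast
        rw [Nat.abs_cast, Nat.abs_cast, pow_add]
        nlinarith [hPM, h2A]
      calc _ ≤ ((2 : ℝ) ^ (hexp K + 2)) ^ m := pow_le_pow_left₀ (by positivity) hle m
        _ = (Y : ℝ) := by rw [hY]; push_cast; rw [← pow_mul, Nat.mul_comm]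
    have h4Y : 4 * Y ≤ hexp (K + 1) := by rw [hY]; exact four_mul_two_pow_le_hexp_succ m K (by omega)
    have hcmp : 1 / (2 : ℝ) ^ hexp (K + 1) ≤ 1 / (2 : ℝ) ^ (4 * Y) :=
      one_div_le_one_div_of_le (by positivity) (pow_le_pow_right₀ (by norm_num) h4Y)
    have e16 : (1 : ℝ) / (2 : ℝ) ^ (4 * Y) = ((1 : ℝ) / 16) ^ Y := by
      rw [pow_mul, one_div_pow]; norm_num
    calc ‖(τ₀ : ℂ) + ξ * (τ₁ : ℂ)‖ ≤ τ₀ + τ₁ := norm_real_combo_le hξn hτ₀0 hτ₁0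
      _ = ∑' k, 1 / (2 : ℝ) ^ hexp (k + (K + 1)) := hsum
      _ ≤ 2 * (1 / (2 : ℝ) ^ hexp (K + 1)) := lambdaH_tail_le (K + 1)
      _ ≤ (3 / 2) * (2 * (1 / (2 : ℝ) ^ hexp (K + 1))) := by
          have : 0 ≤ 2 * (1 / (2 : ℝ) ^ hexp (K + 1)) := by positivity
          linarith only [this]
      _ ≤ (3 / 2) * (2 * (1 / (2 : ℝ) ^ (4 * Y))) :=
          mul_le_mul_of_nonneg_left (mul_le_mul_of_nonneg_left hcmp (by norm_num)) (by norm_num)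
      _ = 3 * ((1 : ℝ) / 16) ^ Y := by rw [e16]; ring
      _ < ((1 : ℝ) / 3) ^ Y := three_mul_sixteenth_pow_lt hY1
      _ ≤ Real.exp (-(Y : ℝ)) := third_pow_le_exp_neg' Y
      _ ≤ Real.exp (-((1 + ((2 ^ hexp K : ℕ) : ℝ) + |((pmP K : ℤ) : ℝ)| + |((pmM K : ℤ) : ℝ)|) ^ m)) :=
          Real.exp_le_exp.mpr (neg_le_neg hX)

/-- **`y_C(ξ)` is hyper-approximable from `ℤ + ℤξ`** (`‖ξ‖ ≤ 1`, `Im ξ ≠ 0`). -/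
theorem hyperLatApprox_yC {ξ : ℂ} (hξn : ‖ξ‖ ≤ 1) (hξi : ξ.im ≠ 0) : HyperLatApprox 1 ξ (yC ξ) := by
  intro m
  obtain ⟨hne, hlt⟩ := yC_partial_approx hξn hξi m
  exact ⟨(pmP (3 * m + 3) : ℤ), (pmM (3 * m + 3) : ℤ), 2 ^ hexp (3 * m + 3), by positivity, hne,
    by exact_mod_cast hlt⟩

/-- The small forms of `(1, ξ, y_C(ξ))` are genuinely ternary at every level. -/
theorem ternarySmallForms_yC {ξ : ℂ} (hξn : ‖ξ‖ ≤ 1) (hξi : ξ.im ≠ 0) (m : ℕ) :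
    ∃ h : Fin 3 → ℤ, (∀ i, h i ≠ 0) ∧
      ‖∑ i, (h i : ℂ) * latTriple 1 ξ (yC ξ) i‖ < Real.exp (-((1 + ∑ i, |(h i : ℝ)|) ^ m)) := by
  obtain ⟨hne, hlt⟩ := yC_partial_approx hξn hξi (m + 1)
  obtain ⟨K, hK⟩ : ∃ K : ℕ, K = 3 * (m + 1) + 3 := ⟨_, rfl⟩
  rw [← hK] at hne hlt
  have hP := one_le_pmP K
  have hM := one_le_pmM (K := K) (by omega)
  have hE2 : (2 : ℕ) ^ hexp K ≠ 0 := pow_ne_zero _ (by norm_num)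
  refine ⟨![-(pmP K : ℤ), -(pmM K : ℤ), ((2 ^ hexp K : ℕ) : ℤ)], ?_, ?_⟩
  · intro i
    match i with
    | 0 => show -(pmP K : ℤ) ≠ 0; omega
    | 1 => show -(pmM K : ℤ) ≠ 0; omega
    | 2 => show ((2 ^ hexp K : ℕ) : ℤ) ≠ 0; exact_mod_cast hE2
  · rw [latTriple_form, latTriple_hsum]
    have hE0 : (0 : ℝ) < ((2 ^ hexp K : ℕ) : ℝ) := by positivity
    have hEC : ((2 ^ hexp K : ℕ) : ℂ) ≠ 0 := by exact_mod_cast hE2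
    set X : ℝ := 1 + ((2 ^ hexp K : ℕ) : ℝ) + |((pmP K : ℤ) : ℝ)| + |((pmM K : ℤ) : ℝ)| with hX
    have hX1 : 1 ≤ X := by
      rw [hX]; linarith only [hE0, abs_nonneg ((pmP K : ℤ) : ℝ), abs_nonneg ((pmM K : ℤ) : ℝ)]
    have hEX : ((2 ^ hexp K : ℕ) : ℝ) ≤ X := by
      rw [hX]; linarith only [abs_nonneg ((pmP K : ℤ) : ℝ), abs_nonneg ((pmM K : ℤ) : ℝ)]
    have e : (((2 ^ hexp K : ℕ)) : ℂ) * yC ξ -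
        ((((pmP K : ℤ)) : ℂ) * 1 + (((pmM K : ℤ)) : ℂ) * ξ) =
        (((2 ^ hexp K : ℕ)) : ℂ) * (yC ξ -
          ((((pmP K : ℤ)) : ℂ) * 1 + (((pmM K : ℤ)) : ℂ) * ξ) / (((2 ^ hexp K : ℕ)) : ℂ)) := by
      field_simp
    have eX : 1 + (|((pmP K : ℤ) : ℝ)| + |((pmM K : ℤ) : ℝ)| + ((2 ^ hexp K : ℕ) : ℝ)) = X := by
      rw [hX]; ring
    rw [e, norm_mul, Complex.norm_natCast, eX]
    calc ((2 ^ hexp K : ℕ) : ℝ) * ‖yC ξ -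
          ((((pmP K : ℤ)) : ℂ) * 1 + (((pmM K : ℤ)) : ℂ) * ξ) / (((2 ^ hexp K : ℕ)) : ℂ)‖
        < ((2 ^ hexp K : ℕ) : ℝ) * Real.exp (-(X ^ (m + 1))) := mul_lt_mul_of_pos_left hlt hE0
      _ ≤ Real.exp (-(X ^ m)) := mul_exp_neg_pow_succ_le hE0 hEX hX1 m

end LatCell

end HyperCell

end Summit.Schanuel.Schanuel.Theorems.RootDecomp1KHyper
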